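import Literature.Probability.LatticeModels.CollarLegModelStrands

/-!
# The medial strand representation of the collar leg model, III: consistent turns, turn phases,
# arrow bits

Third file of the strand representation of `Literature.Probability.LatticeModels.CollarLegModel`
(after `CollarLegModelStrands.lean`: tracked corners, turn factors, six-vertex split; and
`CollarLegModelStrandsExpansion.lean`: the factorisation `weight h = Σ_ω ∏_c turnFactor`). It
isolates the two ingredients of a turn factor — the CONSISTENCY predicate and the PHASE — and the
ARROW BIT of a corner, in the form consumed by the abstract Baxter–Kelland–Wu strand expansion
(`∑_{s consistent} ∏_c exp(i ε(s c) g c) = ∏_{loops} 2cos(Σ g) · ∏_{strands} e^{i ε Σ g}`):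

* `TurnConsistent M h β c` — both corners of the turn are tracked and the two cells it compares
  carry the same height; `turnPhase M h β c` — `phase (h f - h x)` (open, right turn) /
  `phase (h x - h f)` (closed, left turn); `turnFactor_eq_ite` — `turnFactor = if consistent then
  turnPhase else (0 at live / 1 at frozen targets)`;
* `prod_turnFactor_eq` — **the product of the turn factors over any set of corners is an
  indicator (every live turn consistent) times the product of the phases of the consistent turns**;
* `bit M h c = [h x - h f = 1]`; `turnConsistent_iff_bit_eq` — with unit differences, a tracked
  turn is consistent iff the bits of its two corners agree (σ-invariance of the arrow
  configuration); `turnPhase_eq_exp` — with a unit difference the phase is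
  `exp(i ε(bit) (π/12) t)`, `t = -1` open / `+1` closed.

[BaxterKellandWu1976, §3–§4]. Everything is proved; the only new objects are the three definitions.

## References

* R. J. Baxter, S. B. Kelland, F. Y. Wu, J. Phys. A 9 (1976) 397–406, §3–§4. [BaxterKellandWu1976]
-/

namespace Literature.Probability.LatticeModels

namespace CollarLegModel

open Finset

/-! ### Layer 2 (general `M`): consistency predicate, turn phases, the product as an indicator times phases -/

section Layer2

variable (M : CollarLegModel)

/-- **Consistency of the turn at the end of the corner `c`** (the condition under which
`turnFactor` is a phase): both corners are tracked and the two cells the turn compares carry the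
same height (the endpoints along an open edge, the side faces across a closed one). [cite: BaxterKellandWu1976, §4] -/
def TurnConsistent (h : ↥M.freeCells → ℤ) (β : Percolation.BondConfig (Site 2)) (c : Site 2 × Fin 4) : Prop :=
  M.IsTracked c ∧ M.IsTracked (nextCorner β c) ∧
    (cTgt c ∈ β → M.hv h (ofSite c.1) = M.hv h (ofSite (nextCorner β c).1)) ∧
    (cTgt c ∉ β → M.hf h (ofSite (cFace c)) = M.hf h (ofSite (cFace (nextCorner β c))))

open scoped Classical in
/-- **The phase of the turn at the end of the corner `c`**: `phase (h f - h x)` along an open edge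
(right turn inside the face `f`), `phase (h x - h f)` across a closed one (left turn around `x`). [cite: BaxterKellandWu1976, §4] -/
noncomputable def turnPhase (h : ↥M.freeCells → ℤ) (β : Percolation.BondConfig (Site 2)) (c : Site 2 × Fin 4) : ℂ :=
  if cTgt c ∈ β then phase (M.hf h (ofSite (cFace c)) - M.hv h (ofSite c.1))
  else phase (M.hv h (ofSite c.1) - M.hf h (ofSite (cFace c)))

/-- The turn factor is the turn phase on consistent turns, `0` on inconsistent live ones and `1`
on inconsistent frozen ones. [cite: BaxterKellandWu1976, §4] -/
theorem turnFactor_eq_ite (h : ↥M.freeCells → ℤ) (β : Percolation.BondConfig (Site 2)) (c : Site 2 × Fin 4)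
    [Decidable (M.TurnConsistent h β c)] :
    M.turnFactor h β c = if M.TurnConsistent h β c then M.turnPhase h β c else if M.TargetsLive c then 0 else 1 := by
  classical
  unfold turnFactor TurnConsistent turnPhase
  by_cases hb : cTgt c ∈ β
  · simp only [hb, if_true, not_true_eq_false, false_implies, and_true, forall_true_left]
  · simp only [hb, if_false, not_false_eq_true, forall_true_left, false_implies, true_and]

/-- **The product of the turn factors over a set of corners is an indicator times a product of
phases**: it vanishes iff some live turn in the set is inconsistent, and otherwise equals the
product of the turn phases over the consistent turns. [cite: BaxterKellandWu1976, §3–§4] -/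
theorem prod_turnFactor_eq (h : ↥M.freeCells → ℤ) (β : Percolation.BondConfig (Site 2)) (s : Finset (Site 2 × Fin 4))
    [DecidablePred fun c => M.TurnConsistent h β c] :
    ∏ c ∈ s, M.turnFactor h β c =
      if ∀ c ∈ s, M.TargetsLive c → M.TurnConsistent h β c then
        ∏ c ∈ s.filter (fun c => M.TurnConsistent h β c), M.turnPhase h β c
      else 0 := by
  classical
  split_ifs with H
  · rw [prod_filter]
    refine prod_congr rfl fun c hc => ?_
    rw [turnFactor_eq_ite]
    by_cases hc' : M.TurnConsistent h β c
    · rw [if_pos hc', if_pos hc']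
    · rw [if_neg hc', if_neg hc', if_neg (fun hl => hc' (H c hc hl))]
  · push Not at H
    obtain ⟨c, hc, hl, hnc⟩ := H
    exact prod_eq_zero hc (by rw [turnFactor_eq_ite, if_neg hnc, if_pos hl])

/-- **The turn phase as a Baxter–Kelland–Wu quarter-turn phase**: for a corner with unit height
difference, `turnPhase = exp(i ε (π/12) t)` with `ε = ±1` the arrow bit `[h x - h f = 1]` and
`t = -1` along an open edge (right turn), `+1` across a closed one (left turn) — the form consumed
by the abstract strand expansion. [cite: BaxterKellandWu1976, §4] -/
theorem turnPhase_eq_exp (h : ↥M.freeCells → ℤ) (β : Percolation.BondConfig (Site 2)) (c : Site 2 × Fin 4)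
    [Decidable (cTgt c ∈ β)] (hunit : |M.hv h (ofSite c.1) - M.hf h (ofSite (cFace c))| = 1) :
    M.turnPhase h β c = Complex.exp (Complex.I *
      ((if M.hv h (ofSite c.1) - M.hf h (ofSite (cFace c)) = 1 then (1 : ℤ) else -1 : ℤ) : ℂ) *
      (((Real.pi / 12 : ℝ) : ℂ) * ((if cTgt c ∈ β then (-1 : ℤ) else 1 : ℤ) : ℂ))) := by
  classical
  rw [abs_eq (zero_le_one' ℤ)] at hunit
  have key : ∀ k : ℤ, phase k = Complex.exp (Complex.I * (k : ℂ) * ((Real.pi / 12 : ℝ) : ℂ)) := fun k => by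
    rw [phase]; congr 1; push_cast; ring
  unfold turnPhase
  by_cases hb : cTgt c ∈ β <;> rcases hunit with hu | hu
  · rw [if_pos hb, show M.hf h (ofSite (cFace c)) - M.hv h (ofSite c.1) = -1 by omega, key, if_pos hu, if_pos hb]
    push_cast; ring_nf
  · rw [if_pos hb, show M.hf h (ofSite (cFace c)) - M.hv h (ofSite c.1) = 1 by omega, key, if_neg (by omega), if_pos hb]
    push_cast; ring_nf
  · rw [if_neg hb, hu, key, if_pos rfl, if_neg hb]
    push_cast; ring_nf
  · rw [if_neg hb, hu, key, if_neg (by decide), if_neg hb]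
    push_cast; ring_nf

end Layer2

/-! ### Arrow bits and consistency -/

section Bits

variable (M : CollarLegModel)

/-- **The arrow bit** of the corner `c = (x, f)` in the height configuration `h`: `true` iff
`h x - h f = 1` (the level line crosses the corner with the higher cell `x` on its prescribed
side), `false` iff `h x - h f = -1` for a corner with unit difference. [cite: BaxterKellandWu1976, §3] -/
def bit (h : ↥M.freeCells → ℤ) (c : Site 2 × Fin 4) : Bool :=
  decide (M.hv h (ofSite c.1) - M.hf h (ofSite (cFace c)) = 1)

/-- Two unit steps from the same cell agree iff their bits agree. [folklore] -/
theorem eq_iff_decide_eq_of_abs {a b p : ℤ} (ha : |a - p| = 1) (hb : |b - p| = 1) :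
    a = b ↔ decide (a - p = 1) = decide (b - p = 1) := by
  rw [abs_eq (zero_le_one' ℤ)] at ha hb
  rcases ha with ha | ha <;> rcases hb with hb | hb <;> rw [ha, hb] <;> simp <;> omega

/-- Two unit steps to the same cell agree iff their bits agree. [folklore] -/
theorem eq_iff_decide_eq_of_abs' {a p q : ℤ} (hp : |a - p| = 1) (hq : |a - q| = 1) :
    p = q ↔ decide (a - p = 1) = decide (a - q = 1) := by
  rw [abs_eq (zero_le_one' ℤ)] at hp hq
  rcases hp with hp | hp <;> rcases hq with hq | hq <;> rw [hp, hq] <;> simp <;> omega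

/-- **Consistency of a tracked turn with unit differences is equality of the two arrow bits.**
[cite: BaxterKellandWu1976, §4] -/
theorem turnConsistent_iff_bit_eq (h : ↥M.freeCells → ℤ) (β : Percolation.BondConfig (Site 2)) (c : Site 2 × Fin 4)
    (ht : M.IsTracked c) (ht' : M.IsTracked (nextCorner β c))
    (hu : |M.hv h (ofSite c.1) - M.hf h (ofSite (cFace c))| = 1)
    (hu' : |M.hv h (ofSite (nextCorner β c).1) - M.hf h (ofSite (cFace (nextCorner β c)))| = 1) :
    M.TurnConsistent h β c ↔ M.bit h (nextCorner β c) = M.bit h c := by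
  classical
  unfold TurnConsistent bit
  by_cases hb : cTgt c ∈ β
  · have hf : cFace (nextCorner β c) = cFace c := cFace_nextCorner_of_mem hb
    rw [hf] at hu' ⊢
    simp only [ht, ht', true_and, hb, not_true_eq_false, false_implies, and_true, forall_true_left]
    rw [eq_comm, eq_iff_decide_eq_of_abs hu' hu]
  · have hx : (nextCorner β c).1 = c.1 := by rw [nextCorner_of_not_mem hb]
    rw [hx] at hu' ⊢
    simp only [ht, ht', true_and, hb, not_false_eq_true, forall_true_left, false_implies]
    rw [eq_iff_decide_eq_of_abs' hu hu', eq_comm]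

end Bits

end CollarLegModel

end Literature.Probability.LatticeModels
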